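import Literature.Probability.RandomPlanarGeometry.SAWPulledRenewalGap
import Literature.Probability.RandomPlanarGeometry.SAWPulledLargeForceThirdOrder
import HarnessLib

/-!
# The pulled self-avoiding walk on `ℤ²` at large force: Kesten's equation in the EXPANSION VARIABLES
# `u = y e^{-λ_B(y)}`, `t = 1/y` — the cost grading of the irreducible bridges

Topic `Literature/Probability/RandomPlanarGeometry` (uses `SAWPulledRenewalGap.lean`: the pulled Kesten relation
`Σ_i Λ_i(y) e^{-iλ_B(y)} = 1` under the LADDER gap condition (`Zd.pulledGap_ladder`), the block law
`p_i(y) = Λ_i(y) e^{-iλ_B(y)} = Zd.pulledBlockLaw`, `Λ_i(y) = Zd.pulledIrrZ = Σ_{ω ∈ iSAB_i} y^{span ω}`; the three-crossings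
lemma `Zd.three_mul_span_le` (`3·span ≤ i + 2`) of `SAWIrreducibleBridgeCrossings.lean`; and the third-order two-sided window
`Zd.exp_pulledFreeEnergy_window_third` (`y ≥ 9`) of `SAWPulledLargeForceThirdOrder.lean`).

Printed sources. N. R. Beaton, J. Phys. A 48 (2015) 16FT03, §3, Lemma 2: `I(e^{-λ(y)}, y) = 1` for every `y ≥ 1`, where
`I(x, y) = Σ_{irreducible bridges ω} x^{|ω|} y^{span ω}` (via Madras–Slade (4.2.15)); N. Madras, G. Slade, *The Self-Avoiding Walk*
(1993), §4.2, (4.2.15)–(4.2.16), (4.2.20)–(4.2.22) and Theorem 4.2.2; E. J. Janse van Rensburg, S. G. Whittington, J. Phys. A 46 (2013)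
435003, §3.2 Theorem 8 (arXiv v4 p. 11): `λ(y) = log y + O(1)` (first order only). Nothing below beyond Beaton's Lemma 2 is in print;
the lane («pcv-sawmu») uses the equation of this file as the analytic input of the large-force expansion
`e^{λ_B(y)} = y + 2 − 2/y + 6/y² − 20/y³ + 74/y⁴ − …` (orders three to ten are tree/HOME theorems by finite certificates).

## Contents (namespace `Literature.Probability.RandomPlanarGeometry.SAW.Zd`; all PROVED, standard axioms)

* **`pulledGap_largeForce`** — for EVERY `y ≥ 18`: the pulled Kesten relation `Σ_i p_i(y) = 1`, finite mean block length, the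
  all-`n` sandwich `2 − m(y) ≤ a_n(y) ≤ 1` and the renewal limit `a_n(y) → 1/m(y)` — the ladder gap condition of
  `SAWPulledRenewalGap.lean` discharged with the rung `y' = y/2` and the third-order windows (`e^{λ_B(y)} ≥ y + 1`,
  `e^{λ_B(y/2)} ≤ y/2 + 2`, `(y + 4)³ < 4 (y + 1)³`); `hasSum_pulledBlockLaw_largeForce`; `log_add_one_le_pulledBridgeFreeEnergy`.
* the EXPANSION VARIABLE `largeForceU y = u(y) := y · e^{-λ_B(y)}` with `exp_pulledBridgeFreeEnergy_eq_div` (`e^{λ_B(y)} = y / u(y)`),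
  its third-order window `largeForceU_mem_Icc` (`y ≥ 9`), `largeForceU_lt_one`, and `tendsto_largeForceU` (`u(y) → 1`).
* the COST of an irreducible bridge, `cost i ω := i − span ω` (`= #(±e₁-steps) + 2·#(−e₀-steps)` for a step word): `span_le_of_mem`
  (`span ≤ i`), **`two_mul_le_three_mul_cost_add_two`** (`2i ≤ 3·cost + 2`: a cost class contains only finitely many bridges, of
  lengths `≤ 3c/2 + 1`), and the termwise identity `pulledBlockLaw_eq_sum_pow_div` (`p_i(y) = Σ_{ω ∈ iSAB_i} u(y)^i / y^{cost ω}`).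
* the COST COEFFICIENTS `costCoeff c n := #{ω ∈ iSAB_n : cost ω = c}` (so that `P_c(u) := Σ_n costCoeff c n · u^n ∈ ℕ[u]` has degree
  `≤ 3c/2 + 1`): `costCoeff_eq_zero_of_lt`, **`costCoeff_zero`** (`P_0(u) = u`: the only cost-free irreducible bridge is the single
  `+e₀` step), `costCoeff_le_count`.
* ★ **`hasSum_costPoly_largeForce` — KESTEN'S EQUATION IN THE EXPANSION VARIABLES**: for every `y ≥ 18`,
  `Σ_{c ≥ 0} y^{-c} · P_c(u(y)) = 1`, i.e. `HasSum (fun c => (Σ_{n < 2c+2} costCoeff c n · u(y)^n) / y^c) 1` — the renewal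
  equation regraded from the LENGTH of the irreducible bridge to its COST (a rearrangement of a convergent double series of
  non-negative terms). With `t = 1/y`: `G(u, t) := Σ_c t^c P_c(u)` satisfies `G(u(y), 1/y) = 1`, `G(1, 0) = P_0(1) = 1`,
  `∂_u G(1, 0) = 1` — the implicit-function form from which the lane intends to derive the convergent expansion of
  `e^{λ_B(y)} = y / u(y)` in powers of `1/y` with integer coefficients (NOT done here).

Provenance: lane «pcv-sawmu», a-p3 g15 (2026-08-24). No data, no certificates.
-/

noncomputable section

open Finset Filter Topology
open scoped BigOperators
open Literature.Probability.LatticeModels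
open Literature.Probability.RandomPlanarGeometry.SAW

namespace Literature.Probability.RandomPlanarGeometry.SAW.Zd

/-! ### The pulled Kesten relation for every `y ≥ 18` -/

/-- Lower window used for the gap condition: `log (y + 1) ≤ λ_B(y)` for `y ≥ 9` (from the third-order window).
[cite: JansevanRensburgWhittington2013, §3.2 Theorem 8 (arXiv v4 p. 11)] -/
theorem log_add_one_le_pulledBridgeFreeEnergy {y : ℝ} (hy : 9 ≤ y) :
    Real.log (y + 1) ≤ pulledBridgeFreeEnergy 2 y := by
  have hy0 : 0 < y := by linarith
  have hw := (exp_pulledFreeEnergy_window_third hy).1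
  have h2 : 2 / y ≤ 2 / 9 := div_le_div_of_nonneg_left (by norm_num) (by norm_num) hy
  have h3 : 20 / y ^ 3 ≤ 20 / 9 ^ 3 :=
    div_le_div_of_nonneg_left (by norm_num) (by norm_num) (pow_le_pow_left₀ (by norm_num) hy 3)
  have h4 : 0 ≤ 6 / y ^ 2 := by positivity
  have h1 : y + 1 ≤ Real.exp (pulledBridgeFreeEnergy 2 y) := by linarith
  exact (Real.log_le_iff_le_exp (by linarith)).2 h1

/-- Upper window used at the rung: `λ_B(y) ≤ log (y + 2)` for `y ≥ 9` (from the third-order window; the tree's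
`SAWAdsorptionPulledBoundary.lean` has the all-`y` statement under the same name — kept private here to avoid importing that module).
[cite: JansevanRensburgWhittington2013, §3.2 Theorem 8 (arXiv v4 p. 11)] -/
private theorem pulledBridgeFreeEnergy_le_log_add_two' {y : ℝ} (hy : 9 ≤ y) :
    pulledBridgeFreeEnergy 2 y ≤ Real.log (y + 2) := by
  have hy0 : 0 < y := by linarith
  obtain ⟨-, hmid, hup⟩ := exp_pulledFreeEnergy_window_third hy
  have hy3 : (9 : ℝ) ^ 3 ≤ y ^ 3 := pow_le_pow_left₀ (by norm_num) hy 3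
  have h2 : 6 / y ^ 2 ≤ 2 / y / 3 := by
    rw [div_div, div_le_div_iff₀ (by positivity) (by positivity)]; nlinarith
  have h3 : 300 / y ^ 4 ≤ 2 / y / 4 := by
    rw [div_div, div_le_div_iff₀ (by positivity) (by positivity)]; nlinarith
  have h4 : 0 ≤ 2 / y := by positivity
  have h5 : 0 ≤ 20 / y ^ 3 := by positivity
  have h1 : Real.exp (pulledBridgeFreeEnergy 2 y) ≤ y + 2 := by linarith
  exact (Real.le_log_iff_exp_le (by linarith)).2 h1

/-- **The renewal gap at large force — no gap hypothesis left**: for every `y ≥ 18`, the pulled Kesten relation `Σ_i p_i(y) = 1`,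
a finite mean block length, the all-`n` sandwich `2 − m(y) ≤ a_n(y) ≤ 1` and the renewal limit `a_n(y) → 1/m(y)`. The ladder gap
condition `y·U'³ < y'·L³` of `pulledGap_ladder` holds with the rung `y' = y/2`, `L = y + 1`, `U' = y/2 + 2` since
`(y + 4)³ < 4 (y + 1)³` for `y ≥ 18`. [cite: Beaton2015, Lemma 2; MadrasSlade1993, Theorem 4.2.2 (b) and Appendix B, (B.5)] -/
theorem pulledGap_largeForce {y : ℝ} (hy : 18 ≤ y) :
    HasSum (pulledBlockLaw 2 y) 1 ∧ (Summable fun i : ℕ => (i : ℝ) * pulledBlockLaw 2 y i)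
    ∧ (∀ n : ℕ, 2 - pulledMeanBlock 2 y ≤ pulledAmp 2 y n ∧ pulledAmp 2 y n ≤ 1)
    ∧ Tendsto (pulledAmp 2 y) atTop (𝓝 (pulledMeanBlock 2 y)⁻¹) := by
  have hy9 : 9 ≤ y := by linarith
  have hy'9 : 9 ≤ y / 2 := by linarith
  refine pulledGap_ladder (y' := y / 2) (L := y + 1) (U' := y / 2 + 2) (by linarith) (by linarith) (by linarith)
    (by linarith) (log_add_one_le_pulledBridgeFreeEnergy hy9) (pulledBridgeFreeEnergy_le_log_add_two' hy'9) ?_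
  obtain ⟨b, hb, rfl⟩ : ∃ b : ℝ, 0 ≤ b ∧ y = 18 + b := ⟨y - 18, by linarith, by ring⟩
  nlinarith [pow_nonneg hb 2, pow_nonneg hb 3, pow_nonneg hb 4, mul_nonneg hb (pow_nonneg hb 3)]

/-- **The pulled Kesten relation `Σ_i Λ_i(y) e^{-iλ_B(y)} = 1` for every `y ≥ 18`.** [cite: Beaton2015, Lemma 2] -/
theorem hasSum_pulledBlockLaw_largeForce {y : ℝ} (hy : 18 ≤ y) : HasSum (pulledBlockLaw 2 y) 1 :=
  (pulledGap_largeForce hy).1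

/-! ### The expansion variable `u(y) = y e^{-λ_B(y)}` -/

/-- The expansion variable `u(y) := y · e^{-λ_B(y)}` (so that `e^{λ_B(y)} = y / u(y)` and `u(y) → 1`).
[cite: JansevanRensburgWhittington2013, §3.2 Theorem 8 (arXiv v4 p. 11)] -/
def largeForceU (y : ℝ) : ℝ := y * Real.exp (-pulledBridgeFreeEnergy 2 y)

/-- `u(y) > 0` for `y > 0`. [cite: JansevanRensburgWhittington2013, §3.2 Theorem 8 (arXiv v4 p. 11)] -/
theorem largeForceU_pos {y : ℝ} (hy : 0 < y) : 0 < largeForceU y :=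
  mul_pos hy (Real.exp_pos _)

/-- `e^{λ_B(y)} = y / u(y)` for `y > 0`. [cite: JansevanRensburgWhittington2013, §3.2 Theorem 8 (arXiv v4 p. 11)] -/
theorem exp_pulledBridgeFreeEnergy_eq_div {y : ℝ} (hy : 0 < y) :
    Real.exp (pulledBridgeFreeEnergy 2 y) = y / largeForceU y := by
  rw [largeForceU, Real.exp_neg]
  field_simp

/-- `u(y)^i = y^i e^{-iλ_B(y)}`. [cite: JansevanRensburgWhittington2013, §3.2 Theorem 8 (arXiv v4 p. 11)] -/
theorem largeForceU_pow (y : ℝ) (i : ℕ) :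
    largeForceU y ^ i = y ^ i * Real.exp (-(i : ℝ) * pulledBridgeFreeEnergy 2 y) := by
  rw [largeForceU, mul_pow, ← Real.exp_nat_mul]
  congr 2
  ring

/-- **The third-order window for `u(y)`** (`y ≥ 9`):
`y / (y + 2 − 2/y + 6/y² − 20/y³ + 300/y⁴) ≤ u(y) ≤ y / (y + 2 − 2/y + 6/y² − 20/y³)`.
[cite: JansevanRensburgWhittington2013, §3.2 Theorem 8 (arXiv v4 p. 11)] -/
theorem largeForceU_mem_Icc {y : ℝ} (hy : 9 ≤ y) :
    largeForceU y ∈ Set.Icc (y / (y + 2 - 2 / y + 6 / y ^ 2 - 20 / y ^ 3 + 300 / y ^ 4))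
      (y / (y + 2 - 2 / y + 6 / y ^ 2 - 20 / y ^ 3)) := by
  have hy0 : 0 < y := by linarith
  obtain ⟨hlo, hmid, hup⟩ := exp_pulledFreeEnergy_window_third hy
  have hE : 0 < Real.exp (pulledBridgeFreeEnergy 2 y) := Real.exp_pos _
  have hu : largeForceU y = y / Real.exp (pulledBridgeFreeEnergy 2 y) := by
    rw [largeForceU, Real.exp_neg, div_eq_mul_inv]
  have hL0 : 0 < y + 2 - 2 / y + 6 / y ^ 2 - 20 / y ^ 3 := by
    have h2 : 2 / y ≤ 2 / 9 := div_le_div_of_nonneg_left (by norm_num) (by norm_num) hy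
    have h3 : 20 / y ^ 3 ≤ 20 / 9 ^ 3 :=
      div_le_div_of_nonneg_left (by norm_num) (by norm_num) (pow_le_pow_left₀ (by norm_num) hy 3)
    have h4 : 0 ≤ 6 / y ^ 2 := by positivity
    linarith
  rw [hu]
  constructor
  · exact div_le_div_of_nonneg_left hy0.le hE (hmid.trans hup)
  · exact div_le_div_of_nonneg_left hy0.le hL0 hlo

/-- `u(y) < 1` for `y ≥ 9` (`e^{λ_B(y)} ≥ y + 1 > y`). [cite: JansevanRensburgWhittington2013, §3.2 Theorem 8 (arXiv v4 p. 11)] -/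
theorem largeForceU_lt_one {y : ℝ} (hy : 9 ≤ y) : largeForceU y < 1 := by
  have hy0 : 0 < y := by linarith
  have h := (largeForceU_mem_Icc hy).2
  have hL : y < y + 2 - 2 / y + 6 / y ^ 2 - 20 / y ^ 3 := by
    have h2 : 2 / y ≤ 2 / 9 := div_le_div_of_nonneg_left (by norm_num) (by norm_num) hy
    have h3 : 20 / y ^ 3 ≤ 20 / 9 ^ 3 :=
      div_le_div_of_nonneg_left (by norm_num) (by norm_num) (pow_le_pow_left₀ (by norm_num) hy 3)
    have h4 : 0 ≤ 6 / y ^ 2 := by positivity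
    linarith
  have hL0 : 0 < y + 2 - 2 / y + 6 / y ^ 2 - 20 / y ^ 3 := by linarith
  exact lt_of_le_of_lt h ((div_lt_one hL0).2 hL)

/-- **`u(y) → 1` as `y → ∞`** (both ends of the third-order window tend to `1`).
[cite: JansevanRensburgWhittington2013, §3.2 Theorem 8 (arXiv v4 p. 11)] -/
theorem tendsto_largeForceU : Tendsto largeForceU atTop (𝓝 1) := by
  have hinv : Tendsto (fun y : ℝ => y⁻¹) atTop (𝓝 0) := tendsto_inv_atTop_zero
  have hinv2 : Tendsto (fun y : ℝ => (y ^ 2)⁻¹) atTop (𝓝 0) :=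
    tendsto_inv_atTop_zero.comp (tendsto_pow_atTop two_ne_zero)
  have hinv3 : Tendsto (fun y : ℝ => (y ^ 3)⁻¹) atTop (𝓝 0) :=
    tendsto_inv_atTop_zero.comp (tendsto_pow_atTop three_ne_zero)
  have hinv4 : Tendsto (fun y : ℝ => (y ^ 4)⁻¹) atTop (𝓝 0) :=
    tendsto_inv_atTop_zero.comp (tendsto_pow_atTop four_ne_zero)
  -- lower end: y / (y + 2 - 2/y + 6/y² - 20/y³ + 300/y⁴) = 1 / (1 + 2/y - 2/y² + 6/y³ - 20/y⁴ + 300/y⁵)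
  have hlo : Tendsto (fun y : ℝ => y / (y + 2 - 2 / y + 6 / y ^ 2 - 20 / y ^ 3 + 300 / y ^ 4)) atTop (𝓝 1) := by
    have hinv5 : Tendsto (fun y : ℝ => (y ^ 5)⁻¹) atTop (𝓝 0) :=
      tendsto_inv_atTop_zero.comp (tendsto_pow_atTop (by norm_num : (5 : ℕ) ≠ 0))
    have hden : Tendsto (fun y : ℝ => 1 + 2 * y⁻¹ - 2 * (y ^ 2)⁻¹ + 6 * (y ^ 3)⁻¹ - 20 * (y ^ 4)⁻¹ + 300 * (y ^ 5)⁻¹)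
        atTop (𝓝 (1 + 2 * 0 - 2 * 0 + 6 * 0 - 20 * 0 + 300 * 0)) :=
      ((((tendsto_const_nhds.add (hinv.const_mul 2)).sub (hinv2.const_mul 2)).add (hinv3.const_mul 6)).sub
        (hinv4.const_mul 20)).add (hinv5.const_mul 300)
    simp only [mul_zero, add_zero, sub_zero] at hden
    have h1 : Tendsto (fun y : ℝ => (1 + 2 * y⁻¹ - 2 * (y ^ 2)⁻¹ + 6 * (y ^ 3)⁻¹ - 20 * (y ^ 4)⁻¹ + 300 * (y ^ 5)⁻¹)⁻¹)
        atTop (𝓝 1) := by simpa using hden.inv₀ one_ne_zero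
    refine h1.congr' ?_
    filter_upwards [eventually_gt_atTop (0 : ℝ)] with y hy
    have hy0 : y ≠ 0 := hy.ne'
    field_simp
  have hup : Tendsto (fun y : ℝ => y / (y + 2 - 2 / y + 6 / y ^ 2 - 20 / y ^ 3)) atTop (𝓝 1) := by
    have hden : Tendsto (fun y : ℝ => 1 + 2 * y⁻¹ - 2 * (y ^ 2)⁻¹ + 6 * (y ^ 3)⁻¹ - 20 * (y ^ 4)⁻¹)
        atTop (𝓝 (1 + 2 * 0 - 2 * 0 + 6 * 0 - 20 * 0)) :=
      (((tendsto_const_nhds.add (hinv.const_mul 2)).sub (hinv2.const_mul 2)).add (hinv3.const_mul 6)).sub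
        (hinv4.const_mul 20)
    simp only [mul_zero, add_zero, sub_zero] at hden
    have h1 : Tendsto (fun y : ℝ => (1 + 2 * y⁻¹ - 2 * (y ^ 2)⁻¹ + 6 * (y ^ 3)⁻¹ - 20 * (y ^ 4)⁻¹)⁻¹) atTop (𝓝 1) := by
      simpa using hden.inv₀ one_ne_zero
    refine h1.congr' ?_
    filter_upwards [eventually_gt_atTop (0 : ℝ)] with y hy
    have hy0 : y ≠ 0 := hy.ne'
    field_simp
  refine tendsto_of_tendsto_of_tendsto_of_le_of_le' hlo hup ?_ ?_
  · filter_upwards [eventually_ge_atTop (9 : ℝ)] with y hy using (largeForceU_mem_Icc hy).1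
  · filter_upwards [eventually_ge_atTop (9 : ℝ)] with y hy using (largeForceU_mem_Icc hy).2

/-! ### The cost of an irreducible bridge -/

/-- The COST of a bridge `ω` of length `i`: `i − span ω` (for a step word: the number of `±e₁` steps plus twice the number of
`−e₀` steps — the steps not paid for by the pulling force). [cite: MadrasSlade1993, §4.2, eq. (4.2.20)–(4.2.22) (p. 94, 2013 reprint)] -/
def cost (i : ℕ) (ω : ℕ → Site 2) : ℕ := i - (ω i 0).toNat

/-- `span ≤ length` for an irreducible bridge (indeed `3·span ≤ i + 2` and `i ≥ 1`). [cite: MadrasSlade1993, §4.2, eq. (4.2.20)–(4.2.22) (p. 94, 2013 reprint)] -/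
theorem span_le_of_mem {i : ℕ} {ω : ℕ → Site 2} (hω : ω ∈ irreducibleBridges 2 i) : (ω i 0).toNat ≤ i := by
  have h3 := three_mul_span_le hω
  have hi : 1 ≤ i := (mem_irreducibleBridges.1 hω).2.1
  omega

/-- **Finiteness of the cost classes**: `2·i ≤ 3·cost + 2` for an irreducible bridge of length `i` — a cost class `c` contains only
bridges of length `≤ 3c/2 + 1` (from the three-crossings lemma `3·span ≤ i + 2`).
[cite: MadrasSlade1993, §4.2, eq. (4.2.20)–(4.2.22) (p. 94, 2013 reprint)] -/
theorem two_mul_le_three_mul_cost_add_two {i : ℕ} {ω : ℕ → Site 2} (hω : ω ∈ irreducibleBridges 2 i) :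
    2 * i ≤ 3 * cost i ω + 2 := by
  have h3 := three_mul_span_le hω
  have hs := span_le_of_mem hω
  unfold cost
  omega

/-- `cost ≤ length`. [cite: MadrasSlade1993, §4.2, eq. (4.2.20)–(4.2.22) (p. 94, 2013 reprint)] -/
theorem cost_le (i : ℕ) (ω : ℕ → Site 2) : cost i ω ≤ i := Nat.sub_le _ _

/-- **The block law in the expansion variables**: `p_i(y) = Σ_{ω ∈ iSAB_i} u(y)^i / y^{cost ω}` for `y > 0`.
[cite: Beaton2015, §3, Lemma 1, eq. (7)] -/
theorem pulledBlockLaw_eq_sum_pow_div {y : ℝ} (hy : 0 < y) (i : ℕ) :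
    pulledBlockLaw 2 y i = ∑ ω ∈ irreducibleBridges 2 i, largeForceU y ^ i / y ^ cost i ω := by
  rw [pulledBlockLaw, pulledIrrZ, Finset.sum_mul]
  refine Finset.sum_congr rfl fun ω hω => ?_
  have hs := span_le_of_mem hω
  rw [largeForceU_pow, cost, eq_div_iff (pow_ne_zero _ hy.ne'), mul_right_comm, ← pow_add, Nat.add_sub_cancel' hs]

/-! ### The cost coefficients `N_{c,n}` and the polynomials `P_c(u) = Σ_n N_{c,n} u^n` -/

open Classical in
/-- `costCoeff c n = N_{c,n}`: the number of irreducible bridges on `ℤ²` of length `n` and cost `c` (the coefficient of `u^n` in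
`P_c`). [cite: MadrasSlade1993, §4.2, eq. (4.2.20)–(4.2.22) (p. 94, 2013 reprint)] -/
def costCoeff (c n : ℕ) : ℕ := ((irreducibleBridges 2 n).filter fun ω => cost n ω = c).card

/-- `N_{c,n} = 0` unless `2n ≤ 3c + 2` (degree bound `deg P_c ≤ 3c/2 + 1`). [cite: MadrasSlade1993, §4.2, eq. (4.2.20)–(4.2.22) (p. 94, 2013 reprint)] -/
theorem costCoeff_eq_zero_of_lt {c n : ℕ} (h : 3 * c + 2 < 2 * n) : costCoeff c n = 0 := by
  classical
  rw [costCoeff, Finset.card_eq_zero, Finset.filter_eq_empty_iff]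
  intro ω hω hc
  have := two_mul_le_three_mul_cost_add_two hω
  omega

/-- `N_{c,n} = 0` unless `c ≤ n`. [cite: MadrasSlade1993, §4.2, eq. (4.2.20)–(4.2.22) (p. 94, 2013 reprint)] -/
theorem costCoeff_eq_zero_of_lt' {c n : ℕ} (h : n < c) : costCoeff c n = 0 := by
  classical
  rw [costCoeff, Finset.card_eq_zero, Finset.filter_eq_empty_iff]
  intro ω _ hc
  have := cost_le n ω
  omega

/-- `N_{c,n} ≤ c_n` (at most the number of `n`-step self-avoiding walks). [cite: MadrasSlade1993, §1.2] -/
theorem costCoeff_le_count (c n : ℕ) : costCoeff c n ≤ count 2 n := by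
  classical
  calc costCoeff c n ≤ (irreducibleBridges 2 n).card := Finset.card_filter_le _ _
    _ ≤ bridgeCount 2 n := irreducibleBridgeCount_le_bridgeCount n
    _ ≤ count 2 n := bridgeCount_le_count n

/-- **`P_0(u) = u`**: the only cost-free irreducible bridge is the single `+e₀` step — `N_{0,1} = 1` and `N_{0,n} = 0` for `n ≠ 1`.
[cite: MadrasSlade1993, §4.2, eq. (4.2.20)–(4.2.22) (p. 94, 2013 reprint)] -/
theorem costCoeff_zero (n : ℕ) : costCoeff 0 n = if n = 1 then 1 else 0 := by
  classical
  split_ifs with h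
  · subst h
    rw [costCoeff, irreducibleBridges_one, bridges_one]
    rw [Finset.filter_singleton]
    simp [cost, straightWalk]
  · rcases Nat.lt_or_ge 1 n with h1 | h1
    · exact costCoeff_eq_zero_of_lt (by omega)
    · interval_cases n
      · rw [costCoeff, Finset.card_eq_zero, Finset.filter_eq_empty_iff]
        intro ω hω
        exact absurd (mem_irreducibleBridges.1 hω).2.1 (by norm_num)
      · exact absurd rfl h

/-! ### Kesten's equation in the expansion variables -/

/-- The cost-`c`, length-`i` term: `Σ_{ω ∈ iSAB_i, cost ω = c} u(y)^i / y^{cost ω} = N_{c,i} · u(y)^i / y^c`. [folklore] -/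
private theorem sum_filter_cost_eq (y : ℝ) (i c : ℕ) :
    ∑ ω ∈ (irreducibleBridges 2 i).filter (fun ω => cost i ω = c), largeForceU y ^ i / y ^ cost i ω =
      (costCoeff c i : ℝ) * largeForceU y ^ i / y ^ c := by
  classical
  rw [Finset.sum_congr rfl (fun ω hω => by rw [(Finset.mem_filter.1 hω).2]), Finset.sum_const, nsmul_eq_mul, costCoeff,
    mul_div_assoc]

/-- The block law split by cost: `p_i(y) = Σ_{c ≤ i} N_{c,i} u(y)^i / y^c`. [cite: Beaton2015, §3, Lemma 1, eq. (7)] -/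
theorem pulledBlockLaw_eq_sum_costCoeff {y : ℝ} (hy : 0 < y) (i : ℕ) :
    pulledBlockLaw 2 y i = ∑ c ∈ Finset.range (i + 1), (costCoeff c i : ℝ) * largeForceU y ^ i / y ^ c := by
  classical
  rw [pulledBlockLaw_eq_sum_pow_div hy i,
    ← Finset.sum_fiberwise_of_maps_to (g := fun ω => cost i ω) (t := Finset.range (i + 1))
      (fun ω _ => Finset.mem_range.2 (Nat.lt_succ_of_le (cost_le i ω)))]
  exact Finset.sum_congr rfl fun c _ => sum_filter_cost_eq y i c

/-- ★ **Kesten's equation in the expansion variables**: for every `y ≥ 18`,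
`Σ_{c ≥ 0} y^{-c} · P_c(u(y)) = 1` with `P_c(u) = Σ_n N_{c,n} u^n` (a polynomial of degree `≤ 3c/2 + 1`; the inner sum below runs
over `n < 2c + 2`, beyond which `N_{c,n} = 0`) and `u(y) = y e^{-λ_B(y)}` — the pulled Kesten relation `Σ_i Λ_i(y) e^{-iλ_B(y)} = 1`
regraded from the length of the irreducible bridge to its cost (rearrangement of a convergent double series of non-negative terms).
With `t = 1/y` and `G(u, t) := Σ_c t^c P_c(u)`: `G(u(y), 1/y) = 1`, `G(1, 0) = 1`, `∂_u G(1, 0) = P_0'(1) = 1`.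
[cite: Beaton2015, Lemma 2; MadrasSlade1993, §4.2, eq. (4.2.15)–(4.2.16) (p. 93, 2013 reprint)] -/
theorem hasSum_costPoly_largeForce {y : ℝ} (hy : 18 ≤ y) :
    HasSum (fun c : ℕ => (∑ n ∈ Finset.range (2 * c + 2), (costCoeff c n : ℝ) * largeForceU y ^ n) / y ^ c) 1 := by
  have hy0 : 0 < y := by linarith
  set u := largeForceU y with hu
  have hu0 : 0 ≤ u := (largeForceU_pos hy0).le
  -- the double family, indexed by (length, cost)
  set F : ℕ × ℕ → ℝ := fun p => (costCoeff p.2 p.1 : ℝ) * u ^ p.1 / y ^ p.2 with hF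
  have hF0 : ∀ p, 0 ≤ F p := fun p => by positivity
  -- rows: for each length `i`, the costs sum to `p_i(y)`
  have hrow : ∀ i, HasSum (fun c => F (i, c)) (pulledBlockLaw 2 y i) := by
    intro i
    rw [pulledBlockLaw_eq_sum_costCoeff hy0 i]
    refine hasSum_sum_of_ne_finset_zero fun c hc => ?_
    have hc' : i < c := by simpa [Finset.mem_range, Nat.lt_succ_iff] using hc
    simp [hF, costCoeff_eq_zero_of_lt' hc']
  -- summability of the double family (non-negative, iterated sums converge)
  have hK := hasSum_pulledBlockLaw_largeForce hy
  have hsum : Summable F := by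
    refine (summable_prod_of_nonneg hF0).2 ⟨fun i => (hrow i).summable, ?_⟩
    simpa [fun i => (hrow i).tsum_eq] using hK.summable
  have hF1 : HasSum F 1 := by
    have h := hsum.hasSum
    have h' : HasSum (pulledBlockLaw 2 y) (∑' p, F p) := h.prod_fiberwise hrow
    rwa [h'.unique hK] at h
  -- columns: swap the order of summation
  have hG : HasSum (fun q : ℕ × ℕ => F (q.2, q.1)) 1 := by
    have := (Equiv.prodComm ℕ ℕ).hasSum_iff.2 hF1
    exact this
  refine hG.prod_fiberwise fun c => ?_
  rw [Finset.sum_div]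
  refine hasSum_sum_of_ne_finset_zero fun i hi => ?_
  have hi' : 2 * c + 2 ≤ i := by simpa [Finset.mem_range] using hi
  simp [hF, costCoeff_eq_zero_of_lt (show 3 * c + 2 < 2 * i by omega)]

end Literature.Probability.RandomPlanarGeometry.SAW.Zd
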